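import Summits.QuantumFields.YangMills.Theorems.DiagonalMirrorRPRWilsonDiagonalModelOpenBlock

/-!
# Crux `WeakCouplingHypercubicLimitRP` (stmt-QuantumFields-27398) / aside `DiagonalMirrorRPR` (⟨10604⟩), door B, construction F1_diag —
# PAIRING LAYER, step P3d: the lifted cycle CUT AT THE MIRROR SLAB — three atoms, and the pointwise factorisation of the inserted chain

Helper file (`--supports stmt-QuantumFields-27398 --as helper`) of `hand-10604-wilsonDiagModel-3` (director-ym g23, R695/R701-ym, O4 WORD 30:
step P3 of hand-1's ROADMAP-F1diag v4 §1⅞ / hand-2's addendum v5); it closes nothing by itself.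

The lifted chain of the pairing identity lives on `N = (e+1) + (n+2) + (e+1)` sites `U_s = (V_s, Y_s)` (`…MasterLift`), position `s` = layer
`s` of the odd torus, depth `d = e + 1`, free length `n + 2`.  Cutting the cycle at the mirror slab `0`, at `d` and at `N − d` gives three
ATOMS `A₁ = U|[0, e]`, `A₂ = U|[d, N−d−1]`, `A₃ = U|[N−d, N−1]` (`atomApp A₁ A₂ A₃ = Fin.append (Fin.append A₁ A₂) A₃`), each of the
shape "head site, then interior sites" consumed by `blockFun` (`…OpenBlock`): the bonds out of atom `k` run through its interior and end at the
head of atom `k+1` (cyclically).  This file is pure bookkeeping: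
* `atomApp_apply_of_lt`, `…_of_mid`, `…_of_ge` — reading a site off the atoms by its position;
* `atomApp_natCast_add_one`, `atomApp_one_sub`, `atomApp_neg_add_one` — the sites read by the forward insertion (layers `1, …, d`:
  `U_{j+1} = (tail A₁ :: A₂ 0)_j`) and by the reflected insertion (layers `0, −1, …, −d`: `U_{−j} = (tail A₃ :: A₁ 0)_{e−j}`, `U_{−j−1} = (A₃)_{e−j}`);
* `blockFun_atom`, `readR_atom`, `readL_atom` — an atom's bond product and the two dressings ARE `blockFun`'s;
* ★ `insertedChain_atomApp` — the inserted link-kernel chain at `atomApp A₁ A₂ A₃` is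
  `blockFun (readR I) (A₁ 0)₁ (tail A₁) (A₂ 0) · blockFun 1 (A₂ 0)₁ (tail A₂) (A₃ 0) · blockFun (readL I) (A₃ 0)₁ (tail A₃) (A₁ 0)`.

HONEST FRAMING: bookkeeping only; `wilsonDiagonalModel` is NOT landed here; no letter is proved; D1, ⟨27398⟩, S6i, ⟨10604⟩ are OPEN; nothing here
bears on the summit; the Yang–Mills mass gap is NOT proved here or anywhere in the tree.  One plumbing definition (`atomApp`), no `Prop` definition,
no instance, no notation.  Refs: Osterwalder–Seiler, Ann. Phys. 110 (1978) §2–3; Seiler, LNP 159 (1982) Ch. 2.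
-/

set_option autoImplicit false

noncomputable section

open scoped BigOperators
open MeasureTheory Function Fin.NatCast
open Literature.MathematicalPhysics.QuantumLattice Literature.MathematicalPhysics.QuantumFieldTheory
open Summit.QuantumFields.YangMills.Cruxes.DiagonalMirrorRPR.ParityBridgeColdTraces

namespace Summit.QuantumFields.YangMills.Cruxes.DiagonalMirrorRPR.SignTwistedDiagonalTrace.WilsonDiagonal

/-! ## §1 Three atoms on `N = (e+1) + (n+2) + (e+1)` sites -/

section Atoms

variable {α : Type*} {e n : ℕ}

/-- The configuration on `(e+1) + (n+1+1) + (e+1)` sites assembled from its three atoms (positions `[0,e]`, `[e+1, e+n+2]`, `[e+n+3, N−1]`). -/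
def atomApp (A₁ : Fin (e + 1) → α) (A₂ : Fin (n + 1 + 1) → α) (A₃ : Fin (e + 1) → α) :
    Fin (e + 1 + (n + 1 + 1) + (e + 1)) → α :=
  Fin.append (Fin.append A₁ A₂) A₃

/-- Sites in the first atom. -/
theorem atomApp_apply_of_lt (A₁ : Fin (e + 1) → α) (A₂ : Fin (n + 1 + 1) → α) (A₃ : Fin (e + 1) → α)
    (s : Fin (e + 1 + (n + 1 + 1) + (e + 1))) (h : (s : ℕ) < e + 1) : atomApp A₁ A₂ A₃ s = A₁ ⟨s, h⟩ := by
  have hs : s = Fin.castAdd (e + 1) (Fin.castAdd (n + 1 + 1) ⟨s, h⟩) := Fin.ext rfl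
  have h' : atomApp A₁ A₂ A₃ (Fin.castAdd (e + 1) (Fin.castAdd (n + 1 + 1) ⟨s, h⟩)) = A₁ ⟨s, h⟩ := by
    unfold atomApp; rw [Fin.append_left, Fin.append_left]
  rwa [← hs] at h'

/-- Sites in the second atom. -/
theorem atomApp_apply_of_mid (A₁ : Fin (e + 1) → α) (A₂ : Fin (n + 1 + 1) → α) (A₃ : Fin (e + 1) → α)
    (s : Fin (e + 1 + (n + 1 + 1) + (e + 1))) (h₁ : e + 1 ≤ (s : ℕ)) (h₂ : (s : ℕ) < e + 1 + (n + 1 + 1)) :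
    atomApp A₁ A₂ A₃ s = A₂ ⟨s - (e + 1), by omega⟩ := by
  have hs : s = Fin.castAdd (e + 1) (Fin.natAdd (e + 1) ⟨s - (e + 1), by omega⟩) := Fin.ext (by simp; omega)
  have h' : atomApp A₁ A₂ A₃ (Fin.castAdd (e + 1) (Fin.natAdd (e + 1) ⟨s - (e + 1), by omega⟩)) = A₂ ⟨s - (e + 1), by omega⟩ := by
    unfold atomApp; rw [Fin.append_left, Fin.append_right]
  rwa [← hs] at h'

/-- Sites in the third atom. -/
theorem atomApp_apply_of_ge (A₁ : Fin (e + 1) → α) (A₂ : Fin (n + 1 + 1) → α) (A₃ : Fin (e + 1) → α)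
    (s : Fin (e + 1 + (n + 1 + 1) + (e + 1))) (h : e + 1 + (n + 1 + 1) ≤ (s : ℕ)) :
    atomApp A₁ A₂ A₃ s = A₃ ⟨s - (e + 1 + (n + 1 + 1)), by omega⟩ := by
  have hs : s = Fin.natAdd (e + 1 + (n + 1 + 1)) ⟨s - (e + 1 + (n + 1 + 1)), by omega⟩ := Fin.ext (by simp; omega)
  have h' : atomApp A₁ A₂ A₃ (Fin.natAdd (e + 1 + (n + 1 + 1)) ⟨s - (e + 1 + (n + 1 + 1)), by omega⟩) =
      A₃ ⟨s - (e + 1 + (n + 1 + 1)), by omega⟩ := by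
    unfold atomApp; rw [Fin.append_right]
  rwa [← hs] at h'

/-- Reading `p :: x` by position: below the last entry. -/
theorem snoc_apply_of_lt {k : ℕ} (p : Fin k → α) (x : α) (j : Fin (k + 1)) (h : (j : ℕ) < k) :
    (Fin.snoc p x : Fin (k + 1) → α) j = p ⟨j, h⟩ := by
  have hj : j = Fin.castSucc ⟨j, h⟩ := Fin.ext rfl
  have h' : (Fin.snoc p x : Fin (k + 1) → α) (Fin.castSucc ⟨j, h⟩) = p ⟨j, h⟩ := Fin.snoc_castSucc _ _ _
  rwa [← hj] at h'

/-- Reading `p :: x` by position: the last entry. -/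
theorem snoc_apply_of_eq {k : ℕ} (p : Fin k → α) (x : α) (j : Fin (k + 1)) (h : (j : ℕ) = k) :
    (Fin.snoc p x : Fin (k + 1) → α) j = x := by
  have hj : j = Fin.last k := Fin.ext h
  rw [hj, Fin.snoc_last]

/-- **The site after position `j ≤ e` of the first atom**: `U_{j+1} = (tail A₁ :: A₂ 0)_j` (the forward insertion reads the layers `1, …, e+1`). -/
theorem atomApp_natCast_add_one [NeZero (e + 1 + (n + 1 + 1) + (e + 1))] (A₁ : Fin (e + 1) → α) (A₂ : Fin (n + 1 + 1) → α) (A₃ : Fin (e + 1) → α)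
    (j : Fin (e + 1)) :
    atomApp A₁ A₂ A₃ (((j : ℕ) : Fin (e + 1 + (n + 1 + 1) + (e + 1))) + 1) = (Fin.snoc (Fin.tail A₁) (A₂ 0) : Fin (e + 1) → α) j := by
  have h1 : (1 : ℕ) % (e + 1 + (n + 1 + 1) + (e + 1)) = 1 := Nat.mod_eq_of_lt (by omega)
  have hj' : (j : ℕ) % (e + 1 + (n + 1 + 1) + (e + 1)) = j := Nat.mod_eq_of_lt (by omega)
  have hval : ((((j : ℕ) : Fin (e + 1 + (n + 1 + 1) + (e + 1))) + 1 : Fin (e + 1 + (n + 1 + 1) + (e + 1))) : ℕ) = (j : ℕ) + 1 := by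
    rw [Fin.val_add, Fin.val_natCast, Fin.val_one', h1, hj', Nat.mod_eq_of_lt (by omega)]
  by_cases hj : (j : ℕ) < e
  · rw [atomApp_apply_of_lt _ _ _ _ (by omega), snoc_apply_of_lt _ _ _ hj]
    simp only [Fin.tail]
    congr 1
    exact Fin.ext (by simp only [Fin.val_succ]; exact hval)
  · rw [atomApp_apply_of_mid _ _ _ _ (by omega) (by omega), snoc_apply_of_eq _ _ _ (by omega)]
    congr 1
    exact Fin.ext (by simp only [Fin.val_zero, hval]; omega)

/-- **The mirror-image site of position `j+1`**: `U_{1−(j+1)} = U_{−j} = (tail A₃ :: A₁ 0)_{e−j}` (the reflected insertion reads the bond half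
layers of the layers `0, −1, …, −e`). -/
theorem atomApp_one_sub [NeZero (e + 1 + (n + 1 + 1) + (e + 1))] (A₁ : Fin (e + 1) → α) (A₂ : Fin (n + 1 + 1) → α) (A₃ : Fin (e + 1) → α) (j : Fin (e + 1)) :
    atomApp A₁ A₂ A₃ (1 - (((j : ℕ) : Fin (e + 1 + (n + 1 + 1) + (e + 1))) + 1)) = (Fin.snoc (Fin.tail A₃) (A₁ 0) : Fin (e + 1) → α) (Fin.rev j) := by
  have h1 : (1 : ℕ) % (e + 1 + (n + 1 + 1) + (e + 1)) = 1 := Nat.mod_eq_of_lt (by omega)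
  have hj' : (j : ℕ) % (e + 1 + (n + 1 + 1) + (e + 1)) = j := Nat.mod_eq_of_lt (by omega)
  have hval1 : ((((j : ℕ) : Fin (e + 1 + (n + 1 + 1) + (e + 1))) + 1 : Fin (e + 1 + (n + 1 + 1) + (e + 1))) : ℕ) = (j : ℕ) + 1 := by
    rw [Fin.val_add, Fin.val_natCast, Fin.val_one', h1, hj', Nat.mod_eq_of_lt (by omega)]
  have hval : ((1 - (((j : ℕ) : Fin (e + 1 + (n + 1 + 1) + (e + 1))) + 1) : Fin (e + 1 + (n + 1 + 1) + (e + 1))) : ℕ) = if (j : ℕ) = 0 then 0 else (e + 1 + (n + 1 + 1) + (e + 1)) - j := by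
    rw [Fin.val_sub, hval1, Fin.val_one', h1]
    split_ifs with h0
    · rw [h0, show (e + 1 + (n + 1 + 1) + (e + 1)) - (0 + 1) + 1 = (e + 1 + (n + 1 + 1) + (e + 1)) by omega, Nat.mod_self]
    · rw [Nat.mod_eq_of_lt (by omega)]; omega
  by_cases h0 : (j : ℕ) = 0
  · rw [atomApp_apply_of_lt _ _ _ _ (by rw [hval, if_pos h0]; omega), snoc_apply_of_eq _ _ _ (by rw [Fin.val_rev]; omega)]
    congr 1
    exact Fin.ext (by simp only [Fin.val_zero, hval, if_pos h0])
  · rw [atomApp_apply_of_ge _ _ _ _ (by rw [hval, if_neg h0]; omega), snoc_apply_of_lt _ _ _ (by rw [Fin.val_rev]; omega)]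
    simp only [Fin.tail]
    congr 1
    exact Fin.ext (by simp only [Fin.val_succ, Fin.val_rev, hval, if_neg h0]; omega)

/-- **The site before the mirror image**: `U_{−(j+1)} = (A₃)_{e−j}` (the reflected insertion reads the in-slab half layers `−1, …, −e−1`). -/
theorem atomApp_neg_add_one [NeZero (e + 1 + (n + 1 + 1) + (e + 1))] (A₁ : Fin (e + 1) → α) (A₂ : Fin (n + 1 + 1) → α) (A₃ : Fin (e + 1) → α) (j : Fin (e + 1)) :
    atomApp A₁ A₂ A₃ (-(((j : ℕ) : Fin (e + 1 + (n + 1 + 1) + (e + 1))) + 1)) = A₃ (Fin.rev j) := by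
  have h1 : (1 : ℕ) % (e + 1 + (n + 1 + 1) + (e + 1)) = 1 := Nat.mod_eq_of_lt (by omega)
  have hj' : (j : ℕ) % (e + 1 + (n + 1 + 1) + (e + 1)) = j := Nat.mod_eq_of_lt (by omega)
  have hval1 : ((((j : ℕ) : Fin (e + 1 + (n + 1 + 1) + (e + 1))) + 1 : Fin (e + 1 + (n + 1 + 1) + (e + 1))) : ℕ) = (j : ℕ) + 1 := by
    rw [Fin.val_add, Fin.val_natCast, Fin.val_one', h1, hj', Nat.mod_eq_of_lt (by omega)]
  have hval : ((-(((j : ℕ) : Fin (e + 1 + (n + 1 + 1) + (e + 1))) + 1) : Fin (e + 1 + (n + 1 + 1) + (e + 1))) : ℕ) = (e + 1 + (n + 1 + 1) + (e + 1)) - (j + 1) := by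
    rw [Fin.val_neg', hval1, Nat.mod_eq_of_lt (by omega)]
  rw [atomApp_apply_of_ge _ _ _ _ (by rw [hval]; omega)]
  congr 1
  exact Fin.ext (by simp only [Fin.val_rev, hval]; omega)

/-- **The site after a site of an atom**: for the first atom, `U_{s+1} = (tail A₁ :: A₂ 0)_j` at `s = j`. -/
theorem atomApp_castAdd_castAdd_add_one [NeZero (e + 1 + (n + 1 + 1) + (e + 1))] (A₁ : Fin (e + 1) → α) (A₂ : Fin (n + 1 + 1) → α) (A₃ : Fin (e + 1) → α)
    (j : Fin (e + 1)) :
    atomApp A₁ A₂ A₃ (Fin.castAdd (e + 1) (Fin.castAdd (n + 1 + 1) j) + 1) = (Fin.snoc (Fin.tail A₁) (A₂ 0) : Fin (e + 1) → α) j := by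
  rw [← atomApp_natCast_add_one A₁ A₂ A₃ j]
  congr 2
  exact Fin.ext (by rw [Fin.val_castAdd, Fin.val_castAdd, Fin.val_natCast, Nat.mod_eq_of_lt (by omega)])

/-- For the second atom: `U_{s+1} = (tail A₂ :: A₃ 0)_j` at `s = e + 1 + j`. -/
theorem atomApp_castAdd_natAdd_add_one [NeZero (e + 1 + (n + 1 + 1) + (e + 1))] (A₁ : Fin (e + 1) → α) (A₂ : Fin (n + 1 + 1) → α) (A₃ : Fin (e + 1) → α)
    (j : Fin (n + 1 + 1)) :
    atomApp A₁ A₂ A₃ (Fin.castAdd (e + 1) (Fin.natAdd (e + 1) j) + 1) = (Fin.snoc (Fin.tail A₂) (A₃ 0) : Fin (n + 1 + 1) → α) j := by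
  have h1 : (1 : ℕ) % (e + 1 + (n + 1 + 1) + (e + 1)) = 1 := Nat.mod_eq_of_lt (by omega)
  have hval : ((Fin.castAdd (e + 1) (Fin.natAdd (e + 1) j) + 1 : Fin (e + 1 + (n + 1 + 1) + (e + 1))) : ℕ) = e + 1 + j + 1 := by
    rw [Fin.val_add, Fin.val_one', h1, Fin.val_castAdd, Fin.val_natAdd, Nat.mod_eq_of_lt (by omega)]
  by_cases hj : (j : ℕ) < n + 1
  · rw [atomApp_apply_of_mid _ _ _ _ (by omega) (by omega), snoc_apply_of_lt _ _ _ hj]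
    simp only [Fin.tail]
    congr 1
    exact Fin.ext (by simp only [Fin.val_succ, hval]; omega)
  · rw [atomApp_apply_of_ge _ _ _ _ (by omega), snoc_apply_of_eq _ _ _ (by omega)]
    congr 1
    exact Fin.ext (by simp only [Fin.val_zero, hval]; omega)

/-- For the third atom: `U_{s+1} = (tail A₃ :: A₁ 0)_j` at `s = e + 1 + (n + 2) + j` (the last bond closes the cycle at the mirror slab). -/
theorem atomApp_natAdd_add_one [NeZero (e + 1 + (n + 1 + 1) + (e + 1))] (A₁ : Fin (e + 1) → α) (A₂ : Fin (n + 1 + 1) → α) (A₃ : Fin (e + 1) → α)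
    (j : Fin (e + 1)) :
    atomApp A₁ A₂ A₃ (Fin.natAdd (e + 1 + (n + 1 + 1)) j + 1) = (Fin.snoc (Fin.tail A₃) (A₁ 0) : Fin (e + 1) → α) j := by
  have h1 : (1 : ℕ) % (e + 1 + (n + 1 + 1) + (e + 1)) = 1 := Nat.mod_eq_of_lt (by omega)
  have hval : ((Fin.natAdd (e + 1 + (n + 1 + 1)) j + 1 : Fin (e + 1 + (n + 1 + 1) + (e + 1))) : ℕ) =
      if (j : ℕ) < e then e + 1 + (n + 1 + 1) + j + 1 else 0 := by
    rw [Fin.val_add, Fin.val_one', h1, Fin.val_natAdd]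
    split_ifs with h
    · rw [Nat.mod_eq_of_lt (by omega)]
    · have hj : (j : ℕ) = e := by omega
      rw [hj, show e + 1 + (n + 1 + 1) + e + 1 = (e + 1 + (n + 1 + 1) + (e + 1)) by omega, Nat.mod_self]
  by_cases hj : (j : ℕ) < e
  · rw [atomApp_apply_of_ge _ _ _ _ (by rw [hval, if_pos hj]; omega), snoc_apply_of_lt _ _ _ hj]
    simp only [Fin.tail]
    congr 1
    exact Fin.ext (by simp only [Fin.val_succ, hval, if_pos hj]; omega)
  · rw [atomApp_apply_of_lt _ _ _ _ (by rw [hval, if_neg hj]; omega), snoc_apply_of_eq _ _ _ (by omega)]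
    congr 1
    exact Fin.ext (by simp only [Fin.val_zero, hval, if_neg hj])

end Atoms

/-! ## §2 An atom's bond product and dressings are `blockFun`'s -/

section AtomStrings

variable {S : ℕ} {G : Type}

/-- Components of `p :: x`. -/
theorem fst_snoc_pair {k : ℕ} (p : Fin k → (ℕ × HalfCfg S S G) × HalfCfg S S G) (x : (ℕ × HalfCfg S S G) × HalfCfg S S G) (j : Fin (k + 1)) :
    ((Fin.snoc p x : Fin (k + 1) → (ℕ × HalfCfg S S G) × HalfCfg S S G) j).1 = (Fin.snoc (fun i => (p i).1) x.1 : Fin (k + 1) → _) j ∧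
    ((Fin.snoc p x : Fin (k + 1) → (ℕ × HalfCfg S S G) × HalfCfg S S G) j).2 = (Fin.snoc (fun i => (p i).2) x.2 : Fin (k + 1) → _) j := by
  refine Fin.lastCases ?_ (fun i => ?_) j
  · simp only [Fin.snoc_last, and_self]
  · simp only [Fin.snoc_castSucc, and_self]

/-- The lifted-state string of an atom read at `castSucc j` is the atom's own `j`-th state. -/
theorem cons_snoc_castSucc_atom {k : ℕ} (A : Fin (k + 1) → (ℕ × HalfCfg S S G) × HalfCfg S S G) (b : ℕ × HalfCfg S S G) (j : Fin (k + 1)) :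
    (Fin.cons (A 0).1 (Fin.snoc (fun i => (Fin.tail A i).1) b) : Fin (k + 2) → ℕ × HalfCfg S S G) j.castSucc = (A j).1 := by
  rw [Fin.cons_snoc_eq_snoc_cons, Fin.snoc_castSucc]
  refine Fin.cases rfl (fun i => ?_) j
  rw [Fin.cons_succ, Fin.tail]

/-- … and read at `succ j` it is the next site's state. -/
theorem cons_snoc_succ_atom {k : ℕ} (A : Fin (k + 1) → (ℕ × HalfCfg S S G) × HalfCfg S S G) (h : (ℕ × HalfCfg S S G) × HalfCfg S S G)
    (j : Fin (k + 1)) :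
    (Fin.cons (A 0).1 (Fin.snoc (fun i => (Fin.tail A i).1) h.1) : Fin (k + 2) → ℕ × HalfCfg S S G) j.succ =
      ((Fin.snoc (Fin.tail A) h : Fin (k + 1) → (ℕ × HalfCfg S S G) × HalfCfg S S G) j).1 := by
  rw [Fin.cons_succ, (fst_snoc_pair (Fin.tail A) h j).1]

end AtomStrings

section AtomBlock

variable {S : ℕ} [NeZero S] {G : Type} [Group G] {Nc : ℕ} (ρ : G →* Matrix (Fin Nc) (Fin Nc) ℂ)
/-- **An atom's bond product is `blockFun`'s link product**: the bonds out of the sites of the atom `A` (head state `(A 0)₁`, interior `tail A`),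
the last one into the next head `h`. -/
theorem blockFun_atom (β M : ℝ) {k : ℕ} (Jb : (Fin (k + 1) → HalfCfg S S G) → (Fin (k + 2) → ℕ × HalfCfg S S G) → ℝ)
    (A : Fin (k + 1) → (ℕ × HalfCfg S S G) × HalfCfg S S G) (h : (ℕ × HalfCfg S S G) × HalfCfg S S G) :
    blockFun ρ β M Jb (A 0).1 (Fin.tail A) h =
      Jb (Fin.snoc (fun i => (Fin.tail A i).2) h.2) (Fin.cons (A 0).1 (Fin.snoc (fun i => (Fin.tail A i).1) h.1)) *
        ∏ j : Fin (k + 1), linkKer ρ β M (A j).1 ((Fin.snoc (Fin.tail A) h : Fin (k + 1) → _) j).2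
          ((Fin.snoc (Fin.tail A) h : Fin (k + 1) → _) j).1 := by
  unfold blockFun
  congr 1
  refine Finset.prod_congr rfl fun j _ => ?_
  rw [cons_snoc_castSucc_atom, cons_snoc_succ_atom, (fst_snoc_pair (Fin.tail A) h j).2]

omit [NeZero S] [Group G] in
/-- The forward dressing of an atom reads `((tail A :: h)_j)₂` and the in-slab half of `((tail A :: h)_j)₁`. -/
theorem readR_atom {k : ℕ} (I : (Fin (k + 1) → HalfCfg S S G × HalfCfg S S G) → ℝ)
    (A : Fin (k + 1) → (ℕ × HalfCfg S S G) × HalfCfg S S G) (h : (ℕ × HalfCfg S S G) × HalfCfg S S G) :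
    readR I (Fin.snoc (fun i => (Fin.tail A i).2) h.2) (Fin.cons (A 0).1 (Fin.snoc (fun i => (Fin.tail A i).1) h.1)) =
      I fun j => (((Fin.snoc (Fin.tail A) h : Fin (k + 1) → _) j).2, (((Fin.snoc (Fin.tail A) h : Fin (k + 1) → _) j).1).2) := by
  unfold readR
  congr 1
  funext j
  rw [cons_snoc_succ_atom, (fst_snoc_pair (Fin.tail A) h j).2]

omit [NeZero S] [Group G] in
/-- The reflected dressing of an atom reads `Θ ((tail A :: h)_{e−j})₂` and the in-slab half of `(A_{e−j})₁`. -/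
theorem readL_atom {k : ℕ} (I : (Fin (k + 1) → HalfCfg S S G × HalfCfg S S G) → ℝ)
    (A : Fin (k + 1) → (ℕ × HalfCfg S S G) × HalfCfg S S G) (h : (ℕ × HalfCfg S S G) × HalfCfg S S G) :
    readL I (Fin.snoc (fun i => (Fin.tail A i).2) h.2) (Fin.cons (A 0).1 (Fin.snoc (fun i => (Fin.tail A i).1) h.1)) =
      I fun j => (thetaHalf ((Fin.snoc (Fin.tail A) h : Fin (k + 1) → _) (Fin.rev j)).2, ((A (Fin.rev j)).1).2) := by
  unfold readL
  congr 1
  funext j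
  rw [cons_snoc_castSucc_atom, (fst_snoc_pair (Fin.tail A) h (Fin.rev j)).2]

/-- ★ **The inserted link-kernel chain at `atomApp A₁ A₂ A₃` factorises into the three dressed blocks**:
`I(reflected read) · I(forward read) · ∏_s c(V_s, Y_{s+1}, V_{s+1})
 = blockFun (readR I) (A₁ 0)₁ (tail A₁) (A₂ 0) · blockFun 1 (A₂ 0)₁ (tail A₂) (A₃ 0) · blockFun (readL I) (A₃ 0)₁ (tail A₃) (A₁ 0)`. -/
theorem insertedChain_atomApp (β M : ℝ) {e n : ℕ} [NeZero (e + 1 + (n + 1 + 1) + (e + 1))] (I : (Fin (e + 1) → HalfCfg S S G × HalfCfg S S G) → ℝ)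
    (A₁ : Fin (e + 1) → (ℕ × HalfCfg S S G) × HalfCfg S S G) (A₂ : Fin (n + 1 + 1) → (ℕ × HalfCfg S S G) × HalfCfg S S G)
    (A₃ : Fin (e + 1) → (ℕ × HalfCfg S S G) × HalfCfg S S G) :
    I (fun j : Fin (e + 1) =>
        (thetaHalf (atomApp A₁ A₂ A₃ (1 - (((j : ℕ) : Fin (e + 1 + (n + 1 + 1) + (e + 1))) + 1))).2,
          ((atomApp A₁ A₂ A₃ (-(((j : ℕ) : Fin (e + 1 + (n + 1 + 1) + (e + 1))) + 1))).1).2)) *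
      I (fun j : Fin (e + 1) =>
        ((atomApp A₁ A₂ A₃ (((j : ℕ) : Fin (e + 1 + (n + 1 + 1) + (e + 1))) + 1)).2,
          ((atomApp A₁ A₂ A₃ (((j : ℕ) : Fin (e + 1 + (n + 1 + 1) + (e + 1))) + 1)).1).2)) *
      ∏ s : Fin (e + 1 + (n + 1 + 1) + (e + 1)), linkKer ρ β M (atomApp A₁ A₂ A₃ s).1 (atomApp A₁ A₂ A₃ (s + 1)).2
        (atomApp A₁ A₂ A₃ (s + 1)).1 =
    blockFun ρ β M (readR I) (A₁ 0).1 (Fin.tail A₁) (A₂ 0) * blockFun ρ β M (fun _ _ => (1 : ℝ)) (A₂ 0).1 (Fin.tail A₂) (A₃ 0) *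
      blockFun ρ β M (readL I) (A₃ 0).1 (Fin.tail A₃) (A₁ 0) := by
  -- the two reads
  simp only [atomApp_natCast_add_one, atomApp_one_sub, atomApp_neg_add_one]
  -- the chain product over the three atoms
  rw [Fin.prod_univ_add, Fin.prod_univ_add]
  simp only [atomApp_castAdd_castAdd_add_one, atomApp_castAdd_natAdd_add_one, atomApp_natAdd_add_one]
  have h1 : ∀ j : Fin (e + 1), atomApp A₁ A₂ A₃ (Fin.castAdd (e + 1) (Fin.castAdd (n + 1 + 1) j)) = A₁ j := fun j => by
    unfold atomApp; rw [Fin.append_left, Fin.append_left]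
  have h2 : ∀ j : Fin (n + 1 + 1), atomApp A₁ A₂ A₃ (Fin.castAdd (e + 1) (Fin.natAdd (e + 1) j)) = A₂ j := fun j => by
    unfold atomApp; rw [Fin.append_left, Fin.append_right]
  have h3 : ∀ j : Fin (e + 1), atomApp A₁ A₂ A₃ (Fin.natAdd (e + 1 + (n + 1 + 1)) j) = A₃ j := fun j => by
    unfold atomApp; rw [Fin.append_right]
  simp only [h1, h2, h3]
  rw [blockFun_atom, blockFun_atom, blockFun_atom, readR_atom, readL_atom]
  ring

end AtomBlock

end Summit.QuantumFields.YangMills.Cruxes.DiagonalMirrorRPR.SignTwistedDiagonalTrace.WilsonDiagonal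

end
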